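import Summits.Ventures.Crystal3D.Theorems.StickyWulffConstantGenericWallFloorResidualCoverageDefs
import HarnessLib

/-!
# Lane G at charge `c₀`: the STRONGER covering statement the exact certificate proves, and its closer
# (crux `GenericWallFloor`, stmt-Ventures-19480, line `WallLedgerG`; seat 19480-p1 g13, memo `ROCERT-g13.md`)

HONEST FRAMING. Venture `Summits/Ventures/Crystal3D` (cell `crystal3d-full`), helper `--supports` the crux `GenericWallFloor` of
`route-Ventures-StickyWulffConstant`, REGISTERED line `WallLedgerG`, open stub `stub_twoSlabAdhesion`.  BOOKKEEPING, rung credit only;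
F-C1 not moved; NOT the crux.  The named computational fact `ResidualOneSidedCoverage c₀` (`…ResidualCoverageDefs`) is certified
(not proved in the kernel) by the g13 exact engine at `c₀ = 13/25` — and what that certificate actually establishes is the STRONGER,
hypothesis-free covering statement typed here as `CoveredAllAtCharge c₀`: EVERY pair of frames whose fcc lattices are not Barlow-co-axial
is `CoveredAtCharge c₀` (one-sided family up, one-sided family down, or separated tilted slot pair).  The certificate (PREREG amendment
§C′, evidence on 19480): finite part = exact gnomonic box cover for every reduced word class `2 ≤ |κ| ≤ 10` (kit j321901, j321917,
j322016; independently re-verified), uniform tail = the two-steering pigeonhole for every `|κ| ≥ 10` at every `c₀ ≤ 3/5` (kit j322155,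
612 boxes), non-word-presented pairs separated by any steerings (reduced-word rigidity); charge ladder for `|κ| ≤ 6`: PASS `≤ 57/100`,
FAIL at `59/100` in the `Σ9` class around `w₀` (lineage-1 G-inf `0.5893`).

WHAT IS HERE.
* `CoveredAllAtCharge c₀` — the stronger statement (a `def … : Prop`, to be consumed BY NAME like `ResidualOneSidedCoverage`).
* `residualOneSidedCoverage_of_coveredAll` — it implies the registered fact (the fact's other hypotheses are simply dropped);
  `coveredAllAtCharge_mono` — monotone in the charge.
* `genericWallFloorAtCharge_all_of_coveredAll` — THE SIMPLER CLOSER: `P5Exhaustion → StarPairFar → 0 < c₀ → CoveredAllAtCharge c₀ →`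
  every non-co-axial pair satisfies `GenericWallFloorAtCharge c₀` for ALL translations, pointwise by
  `genericWallFloorAtCharge_of_coveredAtCharge` — no case split along the residual chain and no `c₀ ≤ 1`.
WHAT THIS IS NOT: a proof of `CoveredAllAtCharge c₀` for any `c₀` (it is certified computationally, numbers above); not `c₀ = 1`; F-C1 not moved.
-/

noncomputable section

namespace Summit.Ventures.Crystal3D.Theorems

open Summit.Ventures.Crystal3D Finset
open Literature.MathematicalPhysics.StatisticalMechanics (fccStacking barlowStacking IsHaggSeq)
open scoped InnerProductSpace

/-- **`CoveredAllAtCharge c₀` — the hypothesis-free covering statement certified by the exact engine** (19480-p1 g13, `ROCERT-g13.md`):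
every pair of frames `(A₁, A₂)` whose moved fcc lattices are NOT Barlow-co-axial (no common linear Barlow frame up to translations) is
`CoveredAtCharge c₀` — an up-family of grain 1, a down-family of grain 2, or a separated tilted slot pair at flux `≥ 2c₀`.  Certified at
`c₀ = 13/25` (finite part: every reduced word class `2 ≤ |κ| ≤ 10`, every wall normal, exact box cover; uniform tail: every `|κ| ≥ 10` by the
two-steering pigeonhole at every `c₀ ≤ 3/5`); NOT proved in the kernel. -/
def CoveredAllAtCharge (c₀ : ℝ) : Prop :=
  ∀ (A₁ A₂ : EuclideanSpace ℝ (Fin 3) ≃ₗᵢ[ℝ] EuclideanSpace ℝ (Fin 3)),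
    ¬ (∃ (L : EuclideanSpace ℝ (Fin 3) ≃ₗᵢ[ℝ] EuclideanSpace ℝ (Fin 3)) (s₁ s₂ : EuclideanSpace ℝ (Fin 3))
        (σ σ' : ℤ → ℤ), IsHaggSeq σ ∧ IsHaggSeq σ' ∧
        A₁ '' fccStacking 1 (Real.sqrt (2 / 3)) ⊆ (fun p => L p + s₁) '' barlowStacking 1 (Real.sqrt (2 / 3)) σ ∧
        A₂ '' fccStacking 1 (Real.sqrt (2 / 3)) ⊆ (fun p => L p + s₂) '' barlowStacking 1 (Real.sqrt (2 / 3)) σ') →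
    CoveredAtCharge c₀ A₁ A₂

/-- The stronger statement implies the registered named fact `ResidualOneSidedCoverage c₀` (its hypotheses `RayAlignedAt`,
«not in a `Σ9` cell», `¬ SeparatedWideAt` are simply not used). -/
theorem residualOneSidedCoverage_of_coveredAll {c₀ : ℝ} (h : CoveredAllAtCharge c₀) : ResidualOneSidedCoverage c₀ :=
  fun A₁ A₂ hnc _ _ _ _ _ _ _ _ => h A₁ A₂ hnc

/-- Monotonicity in the charge: `CoveredAllAtCharge c₀ → c₀' ≤ c₀ → CoveredAllAtCharge c₀'`. -/
theorem coveredAllAtCharge_mono {c₀ c₀' : ℝ} (h : CoveredAllAtCharge c₀) (hle : c₀' ≤ c₀) : CoveredAllAtCharge c₀' :=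
  fun A₁ A₂ hnc => coveredAtCharge_mono hle (h A₁ A₂ hnc)

/-- **THE SIMPLER LANE-G CLOSER AT CHARGE `c₀ > 0`**: `P5Exhaustion → StarPairFar → CoveredAllAtCharge c₀ →` every NON-co-axial pair of
moved fcc lattices satisfies `GenericWallFloorAtCharge c₀ A₁ t₁ A₂ t₂` (the matrix of the route decl `GenericWallFloor` with `+ 1` replaced
by `+ c₀`), for all translations — pointwise by `genericWallFloorAtCharge_of_coveredAtCharge`; no residual-chain case split, no `c₀ ≤ 1`. -/
theorem genericWallFloorAtCharge_all_of_coveredAll (hE1 : P5Exhaustion) (hSP : StarPairFar)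
    {c₀ : ℝ} (hc₀ : 0 < c₀) (hcov : CoveredAllAtCharge c₀)
    (A₁ : EuclideanSpace ℝ (Fin 3) ≃ₗᵢ[ℝ] EuclideanSpace ℝ (Fin 3)) (t₁ : EuclideanSpace ℝ (Fin 3))
    (A₂ : EuclideanSpace ℝ (Fin 3) ≃ₗᵢ[ℝ] EuclideanSpace ℝ (Fin 3)) (t₂ : EuclideanSpace ℝ (Fin 3))
    (hnc : ¬ ∃ (L : EuclideanSpace ℝ (Fin 3) ≃ₗᵢ[ℝ] EuclideanSpace ℝ (Fin 3)) (s₁ s₂ : EuclideanSpace ℝ (Fin 3))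
        (σ σ' : ℤ → ℤ), IsHaggSeq σ ∧ IsHaggSeq σ' ∧
        (fun p => A₁ p + t₁) '' fccStacking 1 (Real.sqrt (2 / 3)) ⊆
          (fun p => L p + s₁) '' barlowStacking 1 (Real.sqrt (2 / 3)) σ ∧
        (fun p => A₂ p + t₂) '' fccStacking 1 (Real.sqrt (2 / 3)) ⊆
          (fun p => L p + s₂) '' barlowStacking 1 (Real.sqrt (2 / 3)) σ') :
    GenericWallFloorAtCharge c₀ A₁ t₁ A₂ t₂ := by
  obtain ⟨s₀, hs₀, hcert⟩ := exactOnly_star_of_p5Exhaustion hE1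
  exact genericWallFloorAtCharge_of_coveredAtCharge hs₀ hcert hSP hc₀
    (hcov A₁ A₂ (fun h => hnc (coaxial_translate_of_frames t₁ t₂ h))) t₁ t₂

/-- **The crux BY NAME at `c₀ = 1` from the stronger statement** (sanity converse, like `genericWallFloor_of_coverage_one`):
`P5Exhaustion → StarPairFar → CoveredAllAtCharge 1 → GenericWallFloor` — so `CoveredAllAtCharge 1` is a sufficient (not claimed) form. -/
theorem genericWallFloor_of_coveredAll_one (hE1 : P5Exhaustion) (hSP : StarPairFar) (hcov : CoveredAllAtCharge 1) :
    Summit.Ventures.Crystal3D.Theses.StickyWulffConstant.GenericWallFloor :=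
  genericWallFloor_of_coverage_one hE1 hSP (residualOneSidedCoverage_of_coveredAll hcov)

/-- **The LAW-v5 item `GenericWallFloorV5` (stmt-Ventures-23910, `c₀ = 13/25`) from the certified statement**: `P5Exhaustion →
StarPairFar → CoveredAllAtCharge (13/25) → GenericWallFloorV5` — `genericWallFloorAtCharge_all_of_coveredAll` through
the pointwise closer (definitional unfolding of the item, cf. `genericWallFloorV5_iff_atCharge`).  CONDITIONAL (three named computational facts, all certified: E1/C12-55, StarPairFar ×2,
and `CoveredAllAtCharge (13/25)` by the g13 exact certificate); rung credit only. -/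
theorem genericWallFloorV5_of_coveredAll (hE1 : P5Exhaustion) (hSP : StarPairFar) (hcov : CoveredAllAtCharge (13 / 25)) :
    Summit.Ventures.Crystal3D.Theses.StickyWulffConstant.GenericWallFloorV5 := by
  intro A₁ t₁ A₂ t₂ hnc
  exact genericWallFloorAtCharge_all_of_coveredAll hE1 hSP (by norm_num) hcov A₁ t₁ A₂ t₂ hnc

end Summit.Ventures.Crystal3D.Theorems

end
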